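import Summits.CriticalPhenomena.CardyFormulaZ2.Theorems.CardyMagicRigidityPinchResamplingDefsV3
import Summits.CriticalPhenomena.CardyFormulaZ2.Theorems.CardyMagicRigidityNestingRigidityCurveMatching
import Summits.CriticalPhenomena.CardyFormulaZ2.Theorems.CardyMagicRigidityNestingRigidityNoFarBacktrack
import HarnessLib

/-!
# Crux `NestingRigidity`, line `pinch-resampling` (v3): stub S9 `stub_noNeckRigidity` — no-neck rigidity of planar arcs

Crux `Summit.CriticalPhenomena.CardyFormulaZ2.Theses.CardyMagicRigidity.NestingRigidity`
(stmt-CriticalPhenomena-4835), line `pinch-resampling` v3, registered stub S9: `NoNeckRigidity`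
(`CardyMagicRigidityPinchResamplingDefsV3`), the lattice-free deterministic brick D2 of the neck-tomography
transfer.  PROVED here (sorry-free), with the constant `10 θ + 5 ε + 4 ζ ≤ 20 (θ + ζ + ε)`, by assembling

* the KEY LEMMA "no far backtrack of shadows" `diam_image_Icc_le_of_backtrack`
  (`…NestingRigidityNoFarBacktrack`, p150588): if `b` is `ε`-close to `a p` at time `t₁` and to `a q` at a later
  time `t₂` with `q ≤ p`, then `diam a[q, p] ≤ 10 θ + 4 ε + 4 ζ`;
* the cellwise MATCHING bound `reparamDist_le_of_monotone_cells` (`…NestingRigidityCurveMatching`, p150322).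

Proof.  The corridor map is `g t = max {k : ∃ τ ≤ t, dist (a k) (b τ) ≤ ε}` (the farthest shadow seen up to
time `t`; a maximum of a nonempty compact set), corrected to `g 0 = 0`, `g 1 = 1`; it is monotone.  On a time cell
`[τ₁, τ₂]` on which `b` oscillates by `< λ ≤ (r - 2ε)/2`, every `σ ∈ [g τ₁, g τ₂]` satisfies
`dist (a σ) (b τ) ≤ (10 θ + 4 ε + 4 ζ) + ε + λ` for all `τ ∈ [τ₁, τ₂]`: with a shadow `y` of `b τ₁` and a shadow `x`
of `b τ₂`, either `x ≤ σ ≤ g τ₂` (KEY LEMMA between the times `τ₀ ≤ τ₂` of `g τ₂` and of `x`; at `τ₂ = 1` the anchor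
(A1) instead), or `σ ≤ y` (only possible in the first cell, `σ ≤ s₀`, anchor (A0)), or `y < σ < x` (STEP:
`diam a[y, x] ≤ θ`).  The matching bound gives `reparamDist a b ≤ 10 θ + 5 ε + 4 ζ + λ` for every small `λ > 0`.
-/

noncomputable section

namespace Summit.CriticalPhenomena.CardyFormulaZ2.Cruxes.NestingRigidity.PinchResampling

open Set Metric Literature.Probability.RandomPlanarGeometry

/-- **Cell estimate ⇒ distance bound** (the analytic half of stub S9): under the hypotheses of `NoNeckRigidity`,
`Curve.reparamDist a b ≤ 10 θ + 5 ε + 4 ζ`. -/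
theorem reparamDist_le_of_neckFree {a b : Curve ℂ} {r θ ζ ε : ℝ} (hr : 2 * ε < r) (hζ : 0 ≤ ζ)
    (ha : NeckFree r θ a) (hb : NeckFree r θ b) (H1 : ∀ t, ∃ s, dist (b t) (a s) ≤ ε)
    (H2 : ∀ s, (∃ t, dist (a s) (b t) ≤ ε) ∨ dist (a s) (a 0) ≤ ζ ∨ dist (a s) (a 1) ≤ ζ)
    (A0 : ∃ s₀, dist (b 0) (a s₀) ≤ ε ∧ Metric.diam (a '' Set.Icc 0 s₀) ≤ θ)
    (A1 : ∃ s₁, dist (b 1) (a s₁) ≤ ε ∧ Metric.diam (a '' Set.Icc s₁ 1) ≤ θ) :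
    Curve.reparamDist a b ≤ 10 * θ + 5 * ε + 4 * ζ := by
  have KEY := diam_image_Icc_le_of_backtrack a b r θ ζ ε hr hζ ha hb H1 H2 A0
  obtain ⟨α₀, hα₀, hA0⟩ := A0
  obtain ⟨α₁, hα₁, hA1⟩ := A1
  rw [dist_comm] at hα₀ hα₁
  have hε : 0 ≤ ε := by obtain ⟨s, hs⟩ := H1 0; exact dist_nonneg.trans hs
  have hθ : 0 ≤ θ := diam_nonneg.trans hA0
  -- the farthest shadow seen up to time `t`
  set H : unitInterval → Set unitInterval := fun t ↦
    {k | ∃ τ, (k, τ) ∈ {w : unitInterval × unitInterval | w.2 ≤ t ∧ dist (a w.1) (b w.2) ≤ ε}} with hHdef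
  have hHc : ∀ t, IsClosed (H t) := fun t ↦ isClosed_setOf_exists_mem
    ((isClosed_le continuous_snd continuous_const).inter
      (isClosed_le (continuous_dist_pair a b) continuous_const))
  have hHne : ∀ t, (H t).Nonempty := fun t ↦ by
    obtain ⟨s, hs⟩ := H1 t
    exact ⟨s, t, le_rfl, by rwa [dist_comm] at hs⟩
  have hH : ∀ t, ∃ m, IsGreatest (H t) m := fun t ↦ (hHc t).isCompact.exists_isGreatest (hHne t)
  choose h hh using hH
  -- the corridor map
  set g : unitInterval → unitInterval := fun t ↦ if t = 1 then 1 else if t = 0 then 0 else h t with hgdef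
  have hg1 : g 1 = 1 := by simp [hgdef]
  have hg0 : g 0 = 0 := by simp [hgdef]
  have hgt : ∀ t : unitInterval, t ≠ 0 → t ≠ 1 → g t = h t := fun t h0 h1 ↦ by simp [hgdef, h0, h1]
  have hgmono : Monotone g := by
    intro t t' htt
    by_cases h1' : t' = 1
    · rw [h1', hg1]; exact le_top
    have h1 : t ≠ 1 := fun h ↦ h1' (le_antisymm le_top (h ▸ htt))
    by_cases h0 : t = 0
    · rw [h0, hg0]; exact bot_le
    have h0' : t' ≠ 0 := fun h ↦ h0 (le_antisymm (h ▸ htt) bot_le)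
    rw [hgt t h0 h1, hgt t' h0' h1']
    obtain ⟨⟨τ, hτ, hd⟩, -⟩ := hh t
    exact (hh t').2 ⟨τ, hτ.trans htt, hd⟩
  -- the bound for every small `λ > 0`
  have main : ∀ lam : ℝ, 0 < lam → lam ≤ r - 2 * ε →
      Curve.reparamDist a b ≤ (10 * θ + 4 * ε + 4 * ζ) + ε + lam := by
    intro lam hlam hlamr
    obtain ⟨δ, hδ, hδb⟩ := Metric.uniformContinuous_iff.1
      (CompactSpace.uniformContinuous_of_continuous b.continuous) lam hlam
    refine reparamDist_le_of_monotone_cells a b _ δ g hδ hgmono hg0 hg1 ?_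
    intro τ₁ τ₂ hlt hτδ σ' hσ' τ hτ
    -- oscillation of `b` on the cell
    have hosc : ∀ u ∈ Icc τ₁ τ₂, ∀ v ∈ Icc τ₁ τ₂, dist (b u) (b v) < lam := by
      intro u hu v hv
      refine hδb (lt_of_le_of_lt ?_ hτδ)
      rw [Subtype.dist_eq]
      exact Real.dist_le_of_mem_Icc ⟨Subtype.coe_le_coe.2 hu.1, Subtype.coe_le_coe.2 hu.2⟩
        ⟨Subtype.coe_le_coe.2 hv.1, Subtype.coe_le_coe.2 hv.2⟩
    have hτ₁ne : τ₁ ≠ 1 := ne_of_lt (lt_of_lt_of_le hlt le_top)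
    have hτ₂ne : τ₂ ≠ 0 := (ne_of_lt (lt_of_le_of_lt bot_le hlt)).symm
    -- a shadow `y` of `b τ₁` controlling `[g τ₁, y]`
    obtain ⟨y, hy, hyl⟩ : ∃ y, dist (a y) (b τ₁) ≤ ε ∧
        ∀ σ : unitInterval, g τ₁ ≤ σ → σ ≤ y → dist (a σ) (a y) ≤ θ := by
      by_cases h0 : τ₁ = 0
      · subst h0
        refine ⟨α₀, hα₀, fun σ _ hσ ↦ ?_⟩
        exact (dist_le_diam_image a (S := Icc 0 α₀) ⟨bot_le, hσ⟩ ⟨bot_le, le_rfl⟩).trans hA0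
      · obtain ⟨y, hy⟩ := H1 τ₁
        rw [dist_comm] at hy
        refine ⟨y, hy, fun σ h1 h2 ↦ ?_⟩
        have hyle : y ≤ g τ₁ := by
          rw [hgt τ₁ h0 hτ₁ne]
          exact (hh τ₁).2 ⟨τ₁, le_rfl, hy⟩
        rw [le_antisymm h2 (hyle.trans h1), dist_self]
        exact hθ
    -- a shadow `x` of `b τ₂` controlling `[x, g τ₂]`
    obtain ⟨x, hx, hxr⟩ : ∃ x, dist (a x) (b τ₂) ≤ ε ∧
        ∀ σ : unitInterval, σ ≤ g τ₂ → x ≤ σ → dist (a σ) (a x) ≤ 10 * θ + 4 * ε + 4 * ζ := by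
      by_cases h1 : τ₂ = 1
      · subst h1
        refine ⟨α₁, hα₁, fun σ hσ hxσ ↦ ?_⟩
        refine (dist_le_diam_image a (S := Icc α₁ 1) ⟨hxσ, le_top⟩ ⟨le_rfl, le_top⟩).trans ?_
        linarith
      · obtain ⟨x, hx⟩ := H1 τ₂
        rw [dist_comm] at hx
        refine ⟨x, hx, fun σ h2 hxσ ↦ ?_⟩
        rw [hgt τ₂ hτ₂ne h1] at h2
        obtain ⟨⟨τ₀, hτ₀, hd⟩, -⟩ := hh τ₂
        exact (dist_le_diam_image a (S := Icc x (h τ₂)) ⟨hxσ, h2⟩ ⟨le_rfl, hxσ.trans h2⟩).trans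
          (KEY τ₀ τ₂ (h τ₂) x hτ₀ hd hx (hxσ.trans h2))
    -- the cell estimate
    have hbτ₂ : dist (b τ₂) (b τ) ≤ lam := (hosc τ₂ ⟨hlt.le, le_rfl⟩ τ hτ).le
    have hbτ₁ : dist (b τ₁) (b τ) ≤ lam := (hosc τ₁ ⟨le_rfl, hlt.le⟩ τ hτ).le
    have hCθ : θ ≤ 10 * θ + 4 * ε + 4 * ζ := by linarith
    rcases le_or_gt x σ' with hxσ | hσx
    · calc dist (a σ') (b τ) ≤ dist (a σ') (a x) + dist (a x) (b τ₂) + dist (b τ₂) (b τ) :=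
            dist_triangle4 _ _ _ _
        _ ≤ (10 * θ + 4 * ε + 4 * ζ) + ε + lam := by gcongr; exact hxr σ' hσ'.2 hxσ
    rcases le_or_gt σ' y with hσy | hyσ
    · calc dist (a σ') (b τ) ≤ dist (a σ') (a y) + dist (a y) (b τ₁) + dist (b τ₁) (b τ) :=
            dist_triangle4 _ _ _ _
        _ ≤ θ + ε + lam := by gcongr; exact hyl σ' hσ'.1 hσy
        _ ≤ (10 * θ + 4 * ε + 4 * ζ) + ε + lam := by gcongr
    · have hstep : diam (a '' uIcc y x) ≤ θ :=
        diam_le_of_step ha hy hx ((hosc τ₁ ⟨le_rfl, hlt.le⟩ τ₂ ⟨hlt.le, le_rfl⟩).le.trans hlamr)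
      have h1 : dist (a σ') (a x) ≤ θ :=
        (dist_le_diam_image a (S := uIcc y x) (mem_uIcc.2 (Or.inl ⟨hyσ.le, hσx.le⟩))
          right_mem_uIcc).trans hstep
      calc dist (a σ') (b τ) ≤ dist (a σ') (a x) + dist (a x) (b τ₂) + dist (b τ₂) (b τ) :=
            dist_triangle4 _ _ _ _
        _ ≤ θ + ε + lam := by gcongr
        _ ≤ (10 * θ + 4 * ε + 4 * ζ) + ε + lam := by gcongr
  -- let `λ → 0`
  refine le_of_forall_pos_le_add fun η hη ↦ ?_
  have h := main (min η ((r - 2 * ε) / 2)) (lt_min hη (by linarith)) (by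
    have := min_le_right η ((r - 2 * ε) / 2); linarith)
  have := min_le_left η ((r - 2 * ε) / 2)
  linarith

/-- **STUB S9: no-neck rigidity of planar arcs** — `NoNeckRigidity` holds, with room to spare
(`10 θ + 5 ε + 4 ζ ≤ 20 (θ + ζ + ε)`; the signs `0 ≤ θ`, `0 ≤ ε` are forced by the hypotheses). -/
theorem stub_noNeckRigidity : NoNeckRigidity := by
  intro a b r θ ζ ε hr hζ ha hb H1 H2 A0 A1
  have hε : 0 ≤ ε := by obtain ⟨s, hs⟩ := H1 0; exact dist_nonneg.trans hs
  have hθ : 0 ≤ θ := by obtain ⟨s₀, -, h⟩ := A0; exact diam_nonneg.trans h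
  have h := reparamDist_le_of_neckFree hr hζ ha hb H1 H2 A0 A1
  linarith

end Summit.CriticalPhenomena.CardyFormulaZ2.Cruxes.NestingRigidity.PinchResampling

end
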